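import Mathlib
import Literature.NumberTheory.Sieve.IntervalResidueClassSieve
import Literature.NumberTheory.Sieve.LevelOfDistribution
import Literature.NumberTheory.Sieve.SieveFramework
import HarnessLib

/-!
# Route ParityLeakOneFifth, crux `PlainSplit` (item stmt-Parity-18382): elementary tools for the
# calibration lower bound (skeleton v2 `calib-split`)

The calibration lower bound `Π(ε,x) ≥ c₀ x/log x` (stub `stub_calibrationLowerBound` of the birth
skeleton) is assembled at the scale `V_sh·x/log x`, `V_sh(z) = ∏_{2<p<z}(1 − 1/(p−1))` (the density
of the `z`-rough shifts `m − 2` among integers `m` free of primes `< z`), while the route's model is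
normalised by `V(z) = ∏_{p<z}(1 − 1/p)`.  This file collects the elementary facts used by the
composition and by the analytic stubs:

* `prod_one_sub_inv_sq`, `half_le_prod_one_sub_inv_sq`, `V_le_Vsh`:
  `∏_{k=2}^{M}(1 − 1/k²) = (M+1)/(2M)`, hence `∏_{p ∈ S}(1 − 1/(p−1)²) ≥ 1/2` over odd primes and
  `V(z) ≤ V_sh(z)` (`V_sh/V = 2∏_{2<p<z}(1 − 1/(p−1)²) → 2C₂ = 1.3203…`);
* `exists_Vsh_lower`: `V_sh(z) ≥ c/(log z)²` for `z > 2` (from the tree's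
  `IntervalClassSieve.le_prod_one_sub_card_div`);
* `densityProduct_shiftedPrimes_two`: the density product of the tree's sifted sequence
  `SieveSequence.shiftedPrimes 2` (`a_n = Λ(n+2)`, `g(p) = 1/(p−1)` for odd `p`, `g(2) = 0`) over
  `P(z)` is `V_sh(z)`;
* `sum_model_mul_eq`: `Σ_n b_n λ(n+2) F(n+2) = V⁻¹ Σ_{rough n} λ(n+2) F(n+2)`;
* `calib_arith`: the linear arithmetic of the assembly over real variables.
-/

namespace Summit.Parity.GeneralizedHardyLittlewood.Theorems.ParityLeakOneFifth

open Finset Real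
open Literature.NumberTheory.Sieve

/-! ### `V ≤ V_sh` -/

/-- Telescoping: `∏_{k=2}^{M} (1 − 1/k²) = (M+1)/(2M)` for `M ≥ 1`. -/
theorem prod_one_sub_inv_sq (M : ℕ) (hM : 1 ≤ M) :
    ∏ k ∈ Finset.Icc 2 M, (1 - 1 / ((k : ℝ)) ^ 2) = ((M : ℝ) + 1) / (2 * M) := by
  induction M with
  | zero => omega
  | succ n ih =>
    rcases Nat.eq_zero_or_pos n with rfl | hn
    · norm_num
    · rw [Finset.prod_Icc_succ_top (by omega), ih hn]
      have hn0 : (n : ℝ) ≠ 0 := by exact_mod_cast hn.ne'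
      have hn1 : ((n + 1 : ℕ) : ℝ) ≠ 0 := by positivity
      push_cast
      field_simp
      ring

/-- `∏_{p ∈ S} (1 − 1/(p−1)²) ≥ 1/2` for any finite set `S` of integers `≥ 3` (compare with the full
telescoping product over `k = p − 1 ∈ [2, M]`). -/
theorem half_le_prod_one_sub_inv_sq (S : Finset ℕ) (hS : ∀ p ∈ S, 3 ≤ p) :
    (1 : ℝ) / 2 ≤ ∏ p ∈ S, (1 - 1 / (((p : ℝ) - 1)) ^ 2) := by
  set M : ℕ := S.sup id + 1 with hM
  have hM1 : 1 ≤ M := by omega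
  set f : ℕ → ℝ := fun k => 1 - 1 / ((k : ℝ)) ^ 2 with hf
  set g : ℕ → ℕ := fun p => p - 1 with hg
  have himg : S.image g ⊆ Finset.Icc 2 M := by
    intro k hk
    rw [Finset.mem_image] at hk
    obtain ⟨p, hp, rfl⟩ := hk
    have h3 := hS p hp
    have hle : p ≤ S.sup id := Finset.le_sup (f := id) hp
    rw [Finset.mem_Icc, hg]; constructor <;> simp only <;> omega
  have hinj : Set.InjOn g (S : Set ℕ) := by
    intro a ha b hb h
    have := hS a ha; have := hS b hb
    simp only [hg] at h; omega
  have heq : ∏ p ∈ S, (1 - 1 / (((p : ℝ) - 1)) ^ 2) = ∏ k ∈ S.image g, f k := by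
    rw [Finset.prod_image hinj]
    refine Finset.prod_congr rfl fun p hp => ?_
    have h3 := hS p hp
    simp only [hf, hg]
    rw [Nat.cast_sub (by omega)]; push_cast; ring
  rw [heq]
  have hfac : ∀ k ∈ Finset.Icc 2 M, 0 ≤ f k ∧ f k ≤ 1 := by
    intro k hk
    have hk2 : (2 : ℝ) ≤ k := by exact_mod_cast (Finset.mem_Icc.1 hk).1
    simp only [hf]
    constructor
    · rw [sub_nonneg, div_le_one (by positivity)]; nlinarith
    · have : 0 ≤ 1 / ((k : ℝ)) ^ 2 := by positivity
      linarith
  have hsplit := Finset.prod_sdiff himg (f := f)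
  have hle1 : ∏ k ∈ Finset.Icc 2 M \ S.image g, f k ≤ 1 :=
    Finset.prod_le_one (fun k hk => (hfac k (Finset.sdiff_subset hk)).1)
      (fun k hk => (hfac k (Finset.sdiff_subset hk)).2)
  have hge0 : 0 ≤ ∏ k ∈ S.image g, f k :=
    Finset.prod_nonneg fun k hk => (hfac k (himg hk)).1
  have hfull : (1 : ℝ) / 2 ≤ ∏ k ∈ Finset.Icc 2 M, f k := by
    simp only [hf]
    rw [prod_one_sub_inv_sq M hM1]
    have hM0 : (0 : ℝ) < M := by exact_mod_cast hM1
    rw [div_le_div_iff₀ (by norm_num) (by positivity)]; nlinarith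
  calc (1 : ℝ) / 2 ≤ ∏ k ∈ Finset.Icc 2 M, f k := hfull
    _ = (∏ k ∈ Finset.Icc 2 M \ S.image g, f k) * ∏ k ∈ S.image g, f k := hsplit.symm
    _ ≤ 1 * ∏ k ∈ S.image g, f k := mul_le_mul_of_nonneg_right hle1 hge0
    _ = _ := one_mul _

/-- `V(z) ≤ V_sh(z)` for `z > 2`: `∏_{p<z}(1 − 1/p) ≤ ∏_{2<p<z}(1 − 1/(p−1))`
(`V_sh/V = 2∏_{2<p<z}(1 − 1/(p−1)²) ≥ 1`). -/
theorem V_le_Vsh {z : ℝ} (hz : 2 < z) :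
    ∏ p ∈ (Finset.range ⌈z⌉₊).filter Nat.Prime, (1 - 1 / (p : ℝ)) ≤
      ∏ p ∈ (Finset.range ⌈z⌉₊).filter (fun p : ℕ => p.Prime ∧ p ≠ 2), (1 - 1 / ((p : ℝ) - 1)) := by
  set S := (Finset.range ⌈z⌉₊).filter (fun p : ℕ => p.Prime ∧ p ≠ 2) with hS
  have h2 : 2 ∈ (Finset.range ⌈z⌉₊).filter Nat.Prime :=
    Finset.mem_filter.2 ⟨Finset.mem_range.2 (Nat.lt_ceil.2 (by exact_mod_cast hz)), Nat.prime_two⟩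
  have hdecomp : (Finset.range ⌈z⌉₊).filter Nat.Prime = insert 2 S := by
    ext p
    simp only [hS, Finset.mem_insert, Finset.mem_filter, Finset.mem_range]
    constructor
    · rintro ⟨hp, hpr⟩
      by_cases h : p = 2
      · exact Or.inl h
      · exact Or.inr ⟨hp, hpr, h⟩
    · rintro (rfl | ⟨hp, hpr, -⟩)
      · exact ⟨(Finset.mem_filter.1 h2).1 |> Finset.mem_range.1, Nat.prime_two⟩
      · exact ⟨hp, hpr⟩
  have h2S : 2 ∉ S := by simp [hS]
  rw [hdecomp, Finset.prod_insert h2S]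
  have hS3 : ∀ p ∈ S, 3 ≤ p := by
    intro p hp
    obtain ⟨-, hpr, hne⟩ := Finset.mem_filter.1 hp
    have := hpr.two_le; omega
  have hfac : ∀ p ∈ S, (1 - 1 / ((p : ℝ) - 1)) =
      (1 - 1 / (p : ℝ)) * (1 - 1 / (((p : ℝ) - 1)) ^ 2) := by
    intro p hp
    have h3 : (3 : ℝ) ≤ p := by exact_mod_cast hS3 p hp
    have hp0 : (p : ℝ) ≠ 0 := by positivity
    have hp1 : (p : ℝ) - 1 ≠ 0 := by
      have : (0 : ℝ) < (p : ℝ) - 1 := by linarith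
      exact this.ne'
    field_simp
    ring
  rw [Finset.prod_congr rfl hfac, Finset.prod_mul_distrib]
  have hpos : 0 ≤ ∏ p ∈ S, (1 - 1 / (p : ℝ)) :=
    Finset.prod_nonneg fun p hp => by
      have h3 : (3 : ℝ) ≤ p := by exact_mod_cast hS3 p hp
      rw [sub_nonneg, div_le_one (by positivity)]; linarith
  have hhalf := half_le_prod_one_sub_inv_sq S hS3
  calc (1 - 1 / (2 : ℕ)) * ∏ p ∈ S, (1 - 1 / (p : ℝ))
      = (∏ p ∈ S, (1 - 1 / (p : ℝ))) * (1 / 2) := by norm_num; ring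
    _ ≤ (∏ p ∈ S, (1 - 1 / (p : ℝ))) * ∏ p ∈ S, (1 - 1 / (((p : ℝ) - 1)) ^ 2) :=
        mul_le_mul_of_nonneg_left hhalf hpos

/-- `V_sh(z) ≥ c/(log z)²` for all `z > 2`, with an absolute `c > 0` (via `V ≤ V_sh` and the
tree's Mertens-type lower bound `IntervalClassSieve.le_prod_one_sub_card_div`). -/
theorem exists_Vsh_lower : ∃ c : ℝ, 0 < c ∧ ∀ z : ℝ, 2 < z →
    c / Real.log z ^ 2 ≤
      ∏ p ∈ (Finset.range ⌈z⌉₊).filter (fun p : ℕ => p.Prime ∧ p ≠ 2), (1 - 1 / ((p : ℝ) - 1)) := by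
  obtain ⟨c, hc, hV⟩ := IntervalClassSieve.le_prod_one_sub_card_div 1
  refine ⟨c, hc, fun z hz => ?_⟩
  have hPB : Nat.primesBelow ⌈z⌉₊ = (Finset.range ⌈z⌉₊).filter Nat.Prime := rfl
  have h := hV (fun p => ({0} : Finset ℕ)) (fun p _ => by rw [Finset.card_singleton])
    (fun p hp => by rw [Finset.card_singleton]; exact hp.one_lt) z hz.le
  rw [hPB, show (2 * 1 : ℕ) = 2 by norm_num] at h
  have h' : ∏ p ∈ (Finset.range ⌈z⌉₊).filter Nat.Prime, (1 - (#({0} : Finset ℕ) : ℝ) / p) =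
      ∏ p ∈ (Finset.range ⌈z⌉₊).filter Nat.Prime, (1 - 1 / (p : ℝ)) :=
    Finset.prod_congr rfl fun p _ => by rw [Finset.card_singleton, Nat.cast_one]
  rw [h'] at h
  exact h.trans (V_le_Vsh hz)

/-! ### The shifted primes `Λ(n+2)` as a sifted sequence: its density product is `V_sh` -/

/-- For the tree's sifted sequence `SieveSequence.shiftedPrimes 2` (`a_n = Λ(n+2)`, density
`g(d) = 1/φ(d)` for odd `d`, `0` for even `d`), the density product over `P(z)` is
`V_sh(z) = ∏_{2<p<z}(1 − 1/(p−1))`. -/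
theorem densityProduct_shiftedPrimes_two (z : ℝ) :
    (SieveSequence.shiftedPrimes 2).densityProduct (primesProdBelow z) =
      ∏ p ∈ (Finset.range ⌈z⌉₊).filter (fun p : ℕ => p.Prime ∧ p ≠ 2), (1 - 1 / ((p : ℝ) - 1)) := by
  rw [SieveSequence.densityProduct, primeFactors_primesProdBelow]
  have hPB : Nat.primesBelow ⌈z⌉₊ = (Finset.range ⌈z⌉₊).filter Nat.Prime := rfl
  rw [hPB]
  -- the factor at `p = 2` is `1`; split the product according to `p = 2`
  rw [← Finset.prod_filter_mul_prod_filter_not ((Finset.range ⌈z⌉₊).filter Nat.Prime)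
    (fun p : ℕ => p = 2)]
  have h1 : ∏ p ∈ ((Finset.range ⌈z⌉₊).filter Nat.Prime).filter (fun p : ℕ => p = 2),
      (1 - (SieveSequence.shiftedPrimes 2).density p) = 1 := by
    refine Finset.prod_eq_one fun p hp => ?_
    have hp2 : p = 2 := (Finset.mem_filter.1 hp).2
    subst hp2
    simp [SieveSequence.shiftedPrimes, shiftedPrimesDensity_apply]
  rw [h1, one_mul, Finset.filter_filter]
  refine Finset.prod_congr rfl fun p hp => ?_
  obtain ⟨-, hpr, hne⟩ := Finset.mem_filter.1 hp
  have hodd : p.Coprime 2 := (Nat.coprime_primes hpr Nat.prime_two).2 hne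
  have hg : (SieveSequence.shiftedPrimes 2).density p = 1 / ((p : ℝ) - 1) := by
    show shiftedPrimesDensity 2 p = _
    rw [shiftedPrimesDensity_apply, if_pos ⟨hodd, hpr.ne_zero⟩, Nat.totient_prime hpr,
      Nat.cast_sub hpr.one_le, Nat.cast_one, one_div]
  rw [hg]

/-! ### The model sum and the assembly arithmetic -/

/-- The model sum is `1/V` times the sum over the rough `n`. -/
theorem sum_model_mul_eq (x : ℕ) (z V : ℝ) (F : ℕ → ℝ) :
    ∑ n ∈ Finset.Ioc x (2 * x), (if ∀ p ∈ n.primeFactors, z ≤ (p : ℝ) then 1 / V else 0) *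
        (ArithmeticFunction.liouville (n + 2) : ℝ) * F (n + 2) =
      (1 / V) * ∑ n ∈ (Finset.Ioc x (2 * x)).filter (fun n : ℕ => ∀ p ∈ n.primeFactors, z ≤ (p : ℝ)),
        (ArithmeticFunction.liouville (n + 2) : ℝ) * F (n + 2) := by
  rw [Finset.mul_sum, Finset.sum_filter]
  refine Finset.sum_congr rfl fun n _ => ?_
  split_ifs <;> ring

/-- The arithmetic of the assembly of `stub_calibrationLowerBound`, over real variables:
`P − N₂ − 2N₃ − N₃' − 200X + A_w ≤ S`, `P ≥ (35/36)Y₁`, `N₃ ≤ (13/36)Y₁`, `N₂ + N₃' ≤ CεY₁`,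
`A_w ≥ −Y₂/24`, `200X ≤ Y₂/24`, `Cε ≤ 1/12`, `Y₂ ≤ Y₁` (`Y₁ = V_sh x/log x`, `Y₂ = V x/log x`) give
`Y₂/12 ≤ S`. -/
theorem calib_arith {Vsh V xr L C ε P N2 N3 N3' Aw S X45 : ℝ}
    (hR : P - N2 - 2 * N3 - N3' - 200 * X45 + Aw ≤ S)
    (hP : (1 - 1 / 36) * Vsh * xr / L ≤ P) (hE : N3 ≤ (1 / 3 + 1 / 36) * Vsh * xr / L)
    (hB : N2 + N3' ≤ C * ε * Vsh * xr / L) (hA : -(1 / 24 * V * xr / L) ≤ Aw)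
    (hg : 200 * X45 ≤ 1 / 24 * V * xr / L) (hCε : C * ε ≤ 1 / 12) (hVVsh : V ≤ Vsh)
    (hx : 0 < xr) (hL : 0 < L) (hV : 0 ≤ V) : 1 / 12 * xr / L * V ≤ S := by
  set Y₁ : ℝ := Vsh * xr / L with hY₁
  set Y₂ : ℝ := V * xr / L with hY₂
  have hY₂0 : 0 ≤ Y₂ := div_nonneg (mul_nonneg hV hx.le) hL.le
  have hY : Y₂ ≤ Y₁ := div_le_div_of_nonneg_right (mul_le_mul_of_nonneg_right hVVsh hx.le) hL.le
  have hY₁0 : 0 ≤ Y₁ := hY₂0.trans hY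
  have hCY : C * ε * Vsh * xr / L ≤ 1 / 12 * Y₁ := by
    rw [hY₁, show C * ε * Vsh * xr / L = (C * ε) * (Vsh * xr / L) by ring]
    exact mul_le_mul_of_nonneg_right hCε hY₁0
  have e1 : (1 - 1 / 36) * Vsh * xr / L = (1 - 1 / 36) * Y₁ := by rw [hY₁]; ring
  have e2 : (1 / 3 + 1 / 36) * Vsh * xr / L = (1 / 3 + 1 / 36) * Y₁ := by rw [hY₁]; ring
  have e3 : 1 / 24 * V * xr / L = 1 / 24 * Y₂ := by rw [hY₂]; ring
  have e4 : 1 / 12 * xr / L * V = 1 / 12 * Y₂ := by rw [hY₂]; ring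
  rw [e1] at hP
  rw [e2] at hE
  rw [e3] at hA hg
  rw [e4]
  linarith

end Summit.Parity.GeneralizedHardyLittlewood.Theorems.ParityLeakOneFifth
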